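import Summits.QuantumAdvantage.QuantumAdvantage.Theorems.DigitRung.Negative.WalshAndIndependence
import Literature.NumberTheory.QuadraticFields.ThreeTorsionMean
import Literature.NumberTheory.QuadraticFields.ThreeTorsionMeanProofs
import Literature.NumberTheory.Sieve.VinogradovExpSumTools

/-!
# `DigitRung` (stmt-QuantumAdvantage-2423), line `Sketch` — helpers for the stub `stub_fundWeyl`

Elementary tools for the unweighted Weyl sums `Σ_{d ∈ 𝒟_n} e(d r/2^k)` over the `n`-bit `d` with
`−d` a fundamental discriminant (all proved, no named facts):

* geometric sums along a residue class `c (mod q)` in `[0, N)`: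
  `‖Σ e(d x)‖ · ‖q x‖ ≤ 1/2` (`norm_sum_filter_mod_mul_distInt_le`);
* the `2`-adic spacing fact: an odd multiple of `2^{-m}`, `m ≥ 1`, is at distance `≥ 2^{-m}` from `ℤ`
  (`one_le_two_pow_mul_distInt`);
* Möbius inversion of the squarefree condition and the resulting bound
  `‖Σ_{m < N, m ≡ c (4), m squarefree} e(m x)‖ ≤ A·B/2 + N/A` whenever `‖4a²x‖ ≥ 1/B` for all odd `a`
  (`norm_sum_squarefree_mod_four_le`);
* the size of the block: `2^n ≤ 16 · #𝒟_n` for `n ≥ 16` (`two_pow_le_card_block`, the registered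
  anchor of this helper file), from the proved count `abs_card_negFundDiscrs_sub_le`.

The stub itself is `Summit.QuantumAdvantage.DigitRung.Sketch.stub_fundWeyl` in
`ArithStatLadderDigitRungStubFundWeyl.lean`.
-/

noncomputable section

namespace Summit.QuantumAdvantage.DigitRung.Sketch.StubFundWeyl

open scoped Classical FourierTransform ArithmeticFunction.Moebius
open Filter Finset
open Literature.NumberTheory.QuadraticFields
open Literature.NumberTheory.Sieve.Vinogradov
open Summit.QuantumAdvantage.DigitRung.Negative

/-! ### Geometric sums along residue classes -/

/-- Geometric sums from `0`: `‖Σ_{ℓ < M} e(ℓ y)‖ · ‖y‖ ≤ 1/2`. [folklore] -/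
theorem norm_sum_range_fourierChar_mul_distInt_le (M : ℕ) (y : ℝ) :
    ‖∑ ℓ ∈ range M, (𝐞 ((ℓ : ℝ) * y) : ℂ)‖ * distInt y ≤ 1 / 2 := by
  have h1 : ∑ ℓ ∈ range M, (𝐞 (((ℓ : ℝ) + 1) * y) : ℂ) =
      (𝐞 y : ℂ) * ∑ ℓ ∈ range M, (𝐞 ((ℓ : ℝ) * y) : ℂ) := by
    rw [Finset.mul_sum]
    refine Finset.sum_congr rfl fun ℓ _ => ?_
    rw [add_mul, one_mul, AddChar.map_add_eq_mul, Circle.coe_mul, mul_comm]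
  have h2 : ‖∑ ℓ ∈ range M, (𝐞 ((ℓ : ℝ) * y) : ℂ)‖ =
      ‖∑ n ∈ Ioc 0 M, (𝐞 ((n : ℝ) * y) : ℂ)‖ := by
    have hI : Ioc 0 M = Icc 1 M := by
      ext n; simp only [mem_Ioc, mem_Icc]; omega
    rw [hI, ← sum_range_fourierChar_succ_mul, h1, norm_mul, norm_fourierChar, one_mul]
  rw [h2]
  exact norm_sum_Ioc_fourierChar_mul_distInt_le 0 M y

/-- The residue class `c (mod q)` inside `[0, N)` (`c < q`) is the arithmetic progression
`c + qℓ`, `ℓ < ⌈(N − c)/q⌉`. [folklore] -/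
theorem filter_range_mod_eq_map {q c : ℕ} (hc : c < q) (N : ℕ) :
    (range N).filter (fun d => d % q = c) =
      (range ((N + q - 1 - c) / q)).map
        ⟨fun ℓ => c + q * ℓ, fun a b h => by
          have hq : q ≠ 0 := by omega
          simpa [hq] using h⟩ := by
  have hq : 0 < q := lt_of_le_of_lt (Nat.zero_le c) hc
  ext d
  simp only [mem_filter, mem_range, Finset.mem_map, Function.Embedding.coeFn_mk]
  constructor
  · rintro ⟨hdN, hdc⟩
    have h1 : q * (d / q) + c = d := by rw [← hdc]; exact Nat.div_add_mod d q
    refine ⟨d / q, ?_, by omega⟩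
    rw [Nat.lt_iff_add_one_le, Nat.le_div_iff_mul_le hq,
      show (d / q + 1) * q = q * (d / q) + q by ring]
    omega
  · rintro ⟨t, ht, rfl⟩
    rw [Nat.lt_iff_add_one_le, Nat.le_div_iff_mul_le hq,
      show (t + 1) * q = q * t + q by ring] at ht
    refine ⟨by omega, ?_⟩
    rw [Nat.add_mul_mod_self_left, Nat.mod_eq_of_lt hc]

/-- Geometric sums along a residue class: `‖Σ_{d < N, d ≡ c (q)} e(d x)‖ · ‖q x‖ ≤ 1/2`
(`c < q`). [folklore] -/
theorem norm_sum_filter_mod_mul_distInt_le {q c : ℕ} (hc : c < q) (N : ℕ) (x : ℝ) :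
    ‖∑ d ∈ (range N).filter (fun d => d % q = c), (𝐞 ((d : ℝ) * x) : ℂ)‖ *
        distInt ((q : ℝ) * x) ≤ 1 / 2 := by
  rw [filter_range_mod_eq_map hc, Finset.sum_map]
  simp only [Function.Embedding.coeFn_mk]
  have h : ∀ ℓ : ℕ, (𝐞 (((c + q * ℓ : ℕ) : ℝ) * x) : ℂ) =
      (𝐞 ((c : ℝ) * x) : ℂ) * (𝐞 ((ℓ : ℝ) * ((q : ℝ) * x)) : ℂ) := by
    intro ℓ
    rw [show ((c + q * ℓ : ℕ) : ℝ) * x = (c : ℝ) * x + (ℓ : ℝ) * ((q : ℝ) * x) by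
      push_cast; ring, AddChar.map_add_eq_mul, Circle.coe_mul]
  simp_rw [h, ← Finset.mul_sum, norm_mul, norm_fourierChar, one_mul]
  exact norm_sum_range_fourierChar_mul_distInt_le _ _

/-! ### The `2`-adic spacing fact -/

/-- An odd multiple of `2^{-m}`, `m ≥ 1`, is at distance `≥ 2^{-m}` from every integer:
`2^m · ‖u/2^m‖ ≥ 1` for odd `u`. [folklore] -/
theorem one_le_two_pow_mul_distInt {u m : ℕ} (hu : Odd u) (hm : 1 ≤ m) :
    1 ≤ (2 : ℝ) ^ m * distInt ((u : ℝ) / 2 ^ m) := by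
  unfold distInt
  set R : ℤ := round ((u : ℝ) / 2 ^ m) with hR
  have h2 : (0 : ℝ) < 2 ^ m := by positivity
  have hkey : (u : ℝ) / 2 ^ m - R = (((u : ℤ) - R * 2 ^ m : ℤ) : ℝ) / (2 : ℝ) ^ m := by
    push_cast
    field_simp
  have hne : ((u : ℤ) - R * 2 ^ m : ℤ) ≠ 0 := by
    intro h0
    obtain ⟨v, hv⟩ := hu
    obtain ⟨m', rfl⟩ : ∃ m', m = m' + 1 := ⟨m - 1, by omega⟩
    have h2dvd : (2 : ℤ) ∣ (u : ℤ) := ⟨R * 2 ^ m', by rw [pow_succ] at h0; linarith⟩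
    omega
  have h1 : (1 : ℝ) ≤ |(((u : ℤ) - R * 2 ^ m : ℤ) : ℝ)| := by exact_mod_cast Int.one_le_abs hne
  rw [hkey, abs_div, abs_of_pos h2]
  calc (1 : ℝ) ≤ |(((u : ℤ) - R * 2 ^ m : ℤ) : ℝ)| := h1
    _ = (2 : ℝ) ^ m * (|(((u : ℤ) - R * 2 ^ m : ℤ) : ℝ)| / 2 ^ m) := by field_simp

/-- The phases met below: for odd `a`, `r` and `3 ≤ j ≤ k`, `2^k · ‖4a² · r/2^j‖ ≥ 1`
(`4a²r/2^j = a²r/2^{j-2}` has odd numerator). [folklore] -/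
theorem one_le_two_pow_mul_distInt_phase {a r j k : ℕ} (ha : Odd a) (hr : Odd r) (hj : 3 ≤ j)
    (hjk : j ≤ k) :
    1 ≤ (2 : ℝ) ^ k * distInt (4 * ((a : ℝ) ^ 2 * ((r : ℝ) / 2 ^ j))) := by
  obtain ⟨m, rfl⟩ : ∃ m, j = m + 2 := ⟨j - 2, by omega⟩
  have hodd : Odd (a ^ 2 * r) := (ha.pow).mul hr
  have h := one_le_two_pow_mul_distInt hodd (by omega : 1 ≤ m)
  have heq : (4 : ℝ) * ((a : ℝ) ^ 2 * ((r : ℝ) / 2 ^ (m + 2))) = ((a ^ 2 * r : ℕ) : ℝ) / 2 ^ m := by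
    push_cast
    rw [pow_add]
    field_simp
    ring
  rw [heq]
  calc (1 : ℝ) ≤ (2 : ℝ) ^ m * distInt (((a ^ 2 * r : ℕ) : ℝ) / 2 ^ m) := h
    _ ≤ (2 : ℝ) ^ k * distInt (((a ^ 2 * r : ℕ) : ℝ) / 2 ^ m) :=
        mul_le_mul_of_nonneg_right (pow_le_pow_right₀ (by norm_num) (by omega)) (distInt_nonneg _)

/-! ### Möbius inversion of the squarefree condition -/

/-- The multiples of `a²` in the class `c (mod 4)` below `N`, `c ≠ 0`, number at most `N/a²`.
[folklore] -/
theorem card_filter_sq_dvd_le {c : ℕ} (hc : c ≠ 0) (N : ℕ) {a : ℕ} (ha : 1 ≤ a) :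
    ((((range N).filter (fun m => m % 4 = c)).filter (fun m => a ^ 2 ∣ m)).card : ℝ) ≤
      (N : ℝ) / (a : ℝ) ^ 2 := by
  have hsub : ((range N).filter (fun m => m % 4 = c)).filter (fun m => a ^ 2 ∣ m) ⊆
      (Ioc 0 (N - 1)).filter (fun m => a ^ 2 ∣ m) := by
    intro m
    simp only [mem_filter, mem_range, mem_Ioc]
    rintro ⟨⟨hmN, hmc⟩, hdvd⟩
    exact ⟨⟨by omega, by omega⟩, hdvd⟩
  have ha2 : (0 : ℝ) < (a : ℝ) ^ 2 := by positivity
  calc ((((range N).filter (fun m => m % 4 = c)).filter (fun m => a ^ 2 ∣ m)).card : ℝ)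
      ≤ (((Ioc 0 (N - 1)).filter (fun m => a ^ 2 ∣ m)).card : ℝ) := by
        exact_mod_cast card_le_card hsub
    _ = (((N - 1) / a ^ 2 : ℕ) : ℝ) := by rw [Nat.Ioc_filter_dvd_card_eq_div]
    _ ≤ ((N - 1 : ℕ) : ℝ) / ((a ^ 2 : ℕ) : ℝ) := Nat.cast_div_le
    _ ≤ (N : ℝ) / (a : ℝ) ^ 2 := by
        push_cast
        exact div_le_div_of_nonneg_right (by exact_mod_cast Nat.sub_le N 1) ha2.le

/-- **Möbius inversion**: `Σ_{m < N, m ≡ c (4), m sqfree} f(m) = Σ_{1 ≤ a ≤ N} μ(a) Σ_{m < N,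
m ≡ c (4), a² ∣ m} f(m)` for `c ≠ 0` (`𝟙_{sqfree}(m) = Σ_{a² ∣ m} μ(a)`,
`sum_moebius_filter_sq_dvd_eq`). [folklore] -/
theorem sum_filter_squarefree_eq_sum_moebius {c : ℕ} (hc : c ≠ 0) (N : ℕ) (f : ℕ → ℂ) :
    ∑ m ∈ (range N).filter (fun m => m % 4 = c ∧ Squarefree m), f m =
      ∑ a ∈ Icc 1 N, (μ a : ℂ) *
        ∑ m ∈ ((range N).filter (fun m => m % 4 = c)).filter (fun m => a ^ 2 ∣ m), f m := by
  have key : ∀ m ∈ (range N).filter (fun m => m % 4 = c),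
      (if Squarefree m then f m else 0) =
        ∑ a ∈ Icc 1 N, if a ^ 2 ∣ m then (μ a : ℂ) * f m else 0 := by
    intro m hm
    simp only [mem_filter, mem_range] at hm
    have hm0 : 0 < m := by omega
    have hμ : (∑ a ∈ (Icc 1 N).filter (fun a => a ^ 2 ∣ m), (μ a : ℂ)) =
        if Squarefree m then 1 else 0 := by
      have h := sum_moebius_filter_sq_dvd_eq hm0 hm.1.le
      split_ifs at h ⊢ with hsq
      · exact_mod_cast h
      · exact_mod_cast h
    rw [← Finset.sum_filter, ← Finset.sum_mul, hμ]
    split_ifs <;> simp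
  rw [← Finset.filter_filter, Finset.sum_filter Squarefree, Finset.sum_congr rfl key,
    Finset.sum_comm]
  refine Finset.sum_congr rfl fun a _ => ?_
  rw [Finset.sum_filter (fun m => a ^ 2 ∣ m), Finset.mul_sum]
  refine Finset.sum_congr rfl fun m _ => ?_
  split_ifs <;> simp

/-- For even `a` no `m ≡ c (mod 4)`, `c ≠ 0`, is a multiple of `a²`. [folklore] -/
theorem filter_sq_dvd_eq_empty_of_even {c a : ℕ} (hc0 : c ≠ 0) (ha : Even a) (N : ℕ) : ((range N).filter (fun m => m % 4 = c)).filter (fun m => a ^ 2 ∣ m) = ∅ := by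
  rw [Finset.filter_eq_empty_iff]
  intro m hm hdvd
  rw [mem_filter] at hm
  obtain ⟨v, rfl⟩ := ha
  have h4 : 4 ∣ m := (Dvd.intro (v ^ 2) (by ring) : 4 ∣ (v + v) ^ 2).trans hdvd
  omega

/-- For odd `a`, the multiples of `a²` in the class `c (mod 4)` below `N` are the `a²ℓ` with
`ℓ ≡ c (mod 4)`, `ℓ < ⌈N/a²⌉` (as `a² ≡ 1 (mod 4)`). [folklore] -/
theorem filter_sq_dvd_eq_map {c a : ℕ} (ha : Odd a) (N : ℕ) :
    ((range N).filter (fun m => m % 4 = c)).filter (fun m => a ^ 2 ∣ m) =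
      ((range ((N + a ^ 2 - 1) / a ^ 2)).filter (fun ℓ => ℓ % 4 = c)).map
        ⟨fun ℓ => a ^ 2 * ℓ, mul_right_injective₀ (pow_ne_zero 2 ha.pos.ne')⟩ := by
  have hq : 0 < a ^ 2 := pow_pos ha.pos 2
  have hq1 : 1 ≤ a ^ 2 := hq
  have hsq : a ^ 2 % 4 = 1 := by
    obtain ⟨v, rfl⟩ := ha
    rw [show (2 * v + 1) ^ 2 = 4 * (v * v + v) + 1 by ring]
    omega
  have hmod : ∀ ℓ : ℕ, a ^ 2 * ℓ % 4 = ℓ % 4 := by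
    intro ℓ
    rw [Nat.mul_mod, hsq, one_mul, Nat.mod_mod]
  ext m
  simp only [mem_filter, mem_range, Finset.mem_map, Function.Embedding.coeFn_mk]
  constructor
  · rintro ⟨⟨hmN, hmc⟩, ⟨ℓ, rfl⟩⟩
    refine ⟨ℓ, ⟨?_, by rw [← hmod ℓ, hmc]⟩, rfl⟩
    rw [Nat.lt_iff_add_one_le, Nat.le_div_iff_mul_le hq,
      show (ℓ + 1) * a ^ 2 = a ^ 2 * ℓ + a ^ 2 by ring]
    omega
  · rintro ⟨ℓ, ⟨hℓ, hℓc⟩, rfl⟩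
    rw [Nat.lt_iff_add_one_le, Nat.le_div_iff_mul_le hq,
      show (ℓ + 1) * a ^ 2 = a ^ 2 * ℓ + a ^ 2 by ring] at hℓ
    exact ⟨⟨by omega, by rw [hmod ℓ, hℓc]⟩, dvd_mul_right _ _⟩

/-- For odd `a` and `‖4a²x‖ ≥ 1/B`: `‖Σ_{m < N, m ≡ c (4), a² ∣ m} e(m x)‖ ≤ B/2` (a geometric sum
in `ℓ`, `m = a²ℓ`, with step phase `4a²x`). [folklore] -/
theorem norm_sum_filter_sq_dvd_le_of_odd {c a : ℕ} (hc : c < 4) (ha : Odd a) (N : ℕ) (x : ℝ)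
    {B : ℝ} (hB : 1 ≤ B * distInt (4 * ((a : ℝ) ^ 2 * x))) :
    ‖∑ m ∈ ((range N).filter (fun m => m % 4 = c)).filter (fun m => a ^ 2 ∣ m),
        (𝐞 ((m : ℝ) * x) : ℂ)‖ ≤ B / 2 := by
  rw [filter_sq_dvd_eq_map ha, Finset.sum_map]
  simp only [Function.Embedding.coeFn_mk, Nat.cast_mul, Nat.cast_pow]
  have h := norm_sum_filter_mod_mul_distInt_le hc ((N + a ^ 2 - 1) / a ^ 2) ((a : ℝ) ^ 2 * x)
  simp only [Nat.cast_ofNat] at h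
  have heq : ∑ ℓ ∈ (range ((N + a ^ 2 - 1) / a ^ 2)).filter (fun ℓ => ℓ % 4 = c),
      (𝐞 ((a : ℝ) ^ 2 * (ℓ : ℝ) * x) : ℂ) =
      ∑ ℓ ∈ (range ((N + a ^ 2 - 1) / a ^ 2)).filter (fun ℓ => ℓ % 4 = c),
        (𝐞 ((ℓ : ℝ) * ((a : ℝ) ^ 2 * x)) : ℂ) :=
    Finset.sum_congr rfl fun ℓ _ => by ring_nf
  rw [heq]
  set S := ‖∑ ℓ ∈ (range ((N + a ^ 2 - 1) / a ^ 2)).filter (fun ℓ => ℓ % 4 = c),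
        (𝐞 ((ℓ : ℝ) * ((a : ℝ) ^ 2 * x)) : ℂ)‖ with hS
  have hd0 : 0 ≤ distInt (4 * ((a : ℝ) ^ 2 * x)) := distInt_nonneg _
  have hS0 : 0 ≤ S := norm_nonneg _
  have hB0 : 0 ≤ B := by
    by_contra hneg
    push Not at hneg
    nlinarith [mul_nonpos_of_nonpos_of_nonneg hneg.le hd0]
  calc S = S * 1 := (mul_one S).symm
    _ ≤ S * (B * distInt (4 * ((a : ℝ) ^ 2 * x))) := mul_le_mul_of_nonneg_left hB hS0
    _ = B * (S * distInt (4 * ((a : ℝ) ^ 2 * x))) := by ring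
    _ ≤ B * (1 / 2) := mul_le_mul_of_nonneg_left h hB0
    _ = B / 2 := by ring

/-- **The squarefree Weyl sum in a class mod `4`.** If `‖4a²x‖ ≥ 1/B` for every odd `a`, then for
every `A ≥ 1`: `‖Σ_{m < N, m ≡ c (4), m sqfree} e(m x)‖ ≤ A·B/2 + N/A` (`c ∈ {1, 2, 3}`): Möbius
inversion, the geometric-sum bound for `a ≤ A` and the trivial bound `N/a²` for `a > A`.
[folklore] -/
theorem norm_sum_squarefree_mod_four_le {c : ℕ} (hc0 : c ≠ 0) (hc4 : c < 4) (N : ℕ) (x : ℝ)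
    {B : ℝ} (hB : ∀ a : ℕ, Odd a → 1 ≤ B * distInt (4 * ((a : ℝ) ^ 2 * x)))
    {A : ℕ} (hA : 1 ≤ A) :
    ‖∑ m ∈ (range N).filter (fun m => m % 4 = c ∧ Squarefree m), (𝐞 ((m : ℝ) * x) : ℂ)‖ ≤
      (A : ℝ) * B / 2 + (N : ℝ) / A := by
  rw [sum_filter_squarefree_eq_sum_moebius hc0]
  set H : ℕ → ℂ := fun a =>
    ∑ m ∈ ((range N).filter (fun m => m % 4 = c)).filter (fun m => a ^ 2 ∣ m),
      (𝐞 ((m : ℝ) * x) : ℂ) with hH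
  have hB0 : 0 ≤ B := by
    have h1 := hB 1 odd_one
    have hd0 : 0 ≤ distInt (4 * (((1 : ℕ) : ℝ) ^ 2 * x)) := distInt_nonneg _
    by_contra hneg
    push Not at hneg
    nlinarith [mul_nonpos_of_nonpos_of_nonneg hneg.le hd0]
  have hH1 : ∀ a, ‖H a‖ ≤ B / 2 := by
    intro a
    rcases Nat.even_or_odd a with ha | ha
    · simp only [hH]
      rw [filter_sq_dvd_eq_empty_of_even hc0 ha, Finset.sum_empty, norm_zero]
      positivity
    · exact norm_sum_filter_sq_dvd_le_of_odd hc4 ha N x (hB a ha)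
  have hH2 : ∀ a, 1 ≤ a → ‖H a‖ ≤ (N : ℝ) / (a : ℝ) ^ 2 := by
    intro a ha
    calc ‖H a‖ ≤ ∑ m ∈ ((range N).filter (fun m => m % 4 = c)).filter (fun m => a ^ 2 ∣ m),
          ‖(𝐞 ((m : ℝ) * x) : ℂ)‖ := norm_sum_le _ _
      _ = ((((range N).filter (fun m => m % 4 = c)).filter (fun m => a ^ 2 ∣ m)).card : ℝ) := by
          simp
      _ ≤ (N : ℝ) / (a : ℝ) ^ 2 := card_filter_sq_dvd_le hc0 N ha
  have hsplit := (Finset.sum_filter_add_sum_filter_not (Icc 1 N) (fun a => a ≤ A)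
    (fun a => ‖H a‖)).symm
  have hsmall : ∑ a ∈ (Icc 1 N).filter (fun a => a ≤ A), ‖H a‖ ≤ (A : ℝ) * B / 2 := by
    have hcard : ((Icc 1 N).filter (fun a => a ≤ A)).card ≤ A := by
      calc ((Icc 1 N).filter (fun a => a ≤ A)).card ≤ (Icc 1 A).card := by
            refine card_le_card fun a => ?_
            simp only [mem_filter, mem_Icc]
            omega
        _ = A := by simp
    calc ∑ a ∈ (Icc 1 N).filter (fun a => a ≤ A), ‖H a‖
        ≤ ∑ a ∈ (Icc 1 N).filter (fun a => a ≤ A), B / 2 := sum_le_sum fun a _ => hH1 a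
      _ = (((Icc 1 N).filter (fun a => a ≤ A)).card : ℝ) * (B / 2) := by
          rw [sum_const, nsmul_eq_mul]
      _ ≤ (A : ℝ) * (B / 2) :=
          mul_le_mul_of_nonneg_right (by exact_mod_cast hcard) (by linarith)
      _ = (A : ℝ) * B / 2 := by ring
  have hlarge : ∑ a ∈ (Icc 1 N).filter (fun a => ¬ a ≤ A), ‖H a‖ ≤ (N : ℝ) / A := by
    have hI : (Icc 1 N).filter (fun a => ¬ a ≤ A) = Ioc A N := by
      ext a; simp only [mem_filter, mem_Icc, mem_Ioc]; omega
    rw [hI]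
    have hA0 : (0 : ℝ) < A := by exact_mod_cast hA
    calc ∑ a ∈ Ioc A N, ‖H a‖ ≤ ∑ a ∈ Ioc A N, (N : ℝ) * ((a : ℝ) ^ 2)⁻¹ := by
          refine sum_le_sum fun a ha => ?_
          rw [mem_Ioc] at ha
          rw [← div_eq_mul_inv]
          exact hH2 a (by omega)
      _ = (N : ℝ) * ∑ a ∈ Ioc A N, ((a : ℝ) ^ 2)⁻¹ := by rw [Finset.mul_sum]
      _ ≤ (N : ℝ) * (A : ℝ)⁻¹ := by
          gcongr
          rcases le_or_gt A N with hAN | hAN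
          · calc ∑ a ∈ Ioc A N, ((a : ℝ) ^ 2)⁻¹ ≤ (A : ℝ)⁻¹ - (N : ℝ)⁻¹ :=
                  sum_Ioc_inv_sq_le_sub (by omega) hAN
              _ ≤ (A : ℝ)⁻¹ := by
                  have : (0 : ℝ) ≤ (N : ℝ)⁻¹ := by positivity
                  linarith
          · rw [Finset.Ioc_eq_empty (by omega), sum_empty]
            positivity
      _ = (N : ℝ) / A := (div_eq_mul_inv _ _).symm
  calc ‖∑ a ∈ Icc 1 N, (μ a : ℂ) * H a‖ ≤ ∑ a ∈ Icc 1 N, ‖(μ a : ℂ) * H a‖ := norm_sum_le _ _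
    _ ≤ ∑ a ∈ Icc 1 N, ‖H a‖ := by
        refine sum_le_sum fun a _ => ?_
        rw [norm_mul]
        refine mul_le_of_le_one_left (norm_nonneg _) ?_
        rw [Complex.norm_intCast]
        exact_mod_cast ArithmeticFunction.abs_moebius_le_one
    _ = ∑ a ∈ (Icc 1 N).filter (fun a => a ≤ A), ‖H a‖ +
          ∑ a ∈ (Icc 1 N).filter (fun a => ¬ a ≤ A), ‖H a‖ := hsplit
    _ ≤ (A : ℝ) * B / 2 + (N : ℝ) / A := add_le_add hsmall hlarge

/-! ### The size of the block `𝒟_n` -/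

/-- `#{−2^n < D < 0 fundamental} ≤ #𝒟_n + #{−2^{n−1} < D < 0 fundamental}` (`d ↦ −d`). [folklore] -/
theorem card_negFundDiscrs_le_card_block_add {n : ℕ} (hn : 1 ≤ n) :
    (negFundDiscrs (2 ^ n)).card ≤ (block n).card + (negFundDiscrs (2 ^ (n - 1))).card := by
  have hpow : 2 ^ (n - 1) ≤ 2 ^ n := Nat.pow_le_pow_right two_pos (by omega)
  calc (negFundDiscrs (2 ^ n)).card
      ≤ ((block n).map ⟨fun d : ℕ => -(d : ℤ), fun a b h => by simpa using h⟩ ∪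
          negFundDiscrs (2 ^ (n - 1))).card := by
        refine card_le_card fun D hD => ?_
        rw [mem_union, Finset.mem_map]
        rw [mem_negFundDiscrs] at hD
        by_cases hlt : -((2 ^ (n - 1) : ℕ) : ℤ) < D
        · right
          rw [mem_negFundDiscrs]
          exact ⟨⟨hlt, hD.1.2⟩, hD.2⟩
        · left
          obtain ⟨d, hd⟩ := Int.eq_ofNat_of_zero_le (by omega : 0 ≤ -D)
          obtain rfl : D = -(d : ℤ) := by omega
          refine ⟨d, mem_block.mpr ⟨⟨?_, ?_⟩, hD.2⟩, rfl⟩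
          · omega
          · omega
    _ ≤ ((block n).map ⟨fun d : ℕ => -(d : ℤ), fun a b h => by simpa using h⟩).card +
          (negFundDiscrs (2 ^ (n - 1))).card := card_union_le _ _
    _ = (block n).card + (negFundDiscrs (2 ^ (n - 1))).card := by rw [card_map]

/-- **The block is large**: `2^n ≤ 16 · #𝒟_n` for `n ≥ 16` (from `#{−X < D < 0 fundamental} =
(3/π²) X + O(8√X)`, `abs_card_negFundDiscrs_sub_le`, differenced over `[2^{n−1}, 2^n)`).
[folklore] -/
theorem two_pow_le_card_block :
    ∀ n : ℕ, 16 ≤ n → (2 : ℝ) ^ n ≤ 16 * ((block n).card : ℝ) := by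
  intro n hn
  have h1 : ((negFundDiscrs (2 ^ n)).card : ℝ) ≤
      (block n).card + (negFundDiscrs (2 ^ (n - 1))).card := by
    exact_mod_cast card_negFundDiscrs_le_card_block_add (by omega : 1 ≤ n)
  have h2 := abs_card_negFundDiscrs_sub_le (2 ^ n)
  have h3 := abs_card_negFundDiscrs_sub_le (2 ^ (n - 1))
  push_cast at h2 h3
  have hXY : (2 : ℝ) ^ n = 2 * 2 ^ (n - 1) := by
    rw [← pow_succ']; congr 1; omega
  rw [hXY] at h2 ⊢
  set Y : ℝ := (2 : ℝ) ^ (n - 1) with hY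
  have hY15 : (32768 : ℝ) ≤ Y := by
    calc (32768 : ℝ) = 2 ^ 15 := by norm_num
      _ ≤ 2 ^ (n - 1) := pow_le_pow_right₀ (by norm_num) (by omega)
  have hπ : Real.pi ^ 2 < 10 := by nlinarith [Real.pi_lt_d2, Real.pi_pos]
  have hc : 3 / 10 ≤ 3 / Real.pi ^ 2 :=
    div_le_div_of_nonneg_left (by norm_num) (by positivity) hπ.le
  have hcY : 3 / 10 * Y ≤ 3 / Real.pi ^ 2 * Y := mul_le_mul_of_nonneg_right hc (by positivity)
  have hs1 : Real.sqrt (2 * Y) ≤ Y / 128 := by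
    rw [Real.sqrt_le_left (by positivity)]
    nlinarith
  have hs2 : Real.sqrt Y ≤ Real.sqrt (2 * Y) := Real.sqrt_le_sqrt (by linarith)
  have h2' := (abs_le.mp h2).1
  have h3' := (abs_le.mp h3).2
  linarith

end Summit.QuantumAdvantage.DigitRung.Sketch.StubFundWeyl

end
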